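import Summits.BirchSwinnertonDyer.Rank1Residual.GaloisImage.TameThreeKodairaShapeLocal
import Literature.NumberTheory.DiophantineGeometry.TateAlgorithmIstarEvalProofs
import Literature.NumberTheory.DiophantineGeometry.MinimalDiscriminantSpanProofs
import Literature.NumberTheory.DiophantineGeometry.TateAlgorithmOrdDiscriminant
import Literature.NumberTheory.EllipticCurves.GlobalMinimalModel
import Literature.NumberTheory.EllipticCurves.HasseWeilAbelianConductor
import Literature.NumberTheory.EllipticCurves.ExceptionalPrimesDensityModels
import Literature.NumberTheory.GaloisRepresentations.HeckeCharacterProofs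
import Literature.RingTheory.DiscreteValuationRing.AdicCompletionHensel
import HarnessLib

/-!
# Kodaira types `III` / `III*` at a place of `ℚ`: an INTEGER translate of the global minimal model
# in `III`-shape (`p ∣ b₂`, `p ∥ b₄`, `p² ∣ b₆`) resp. `III*`-shape (`p² ∣ b₂`, `p³ ∥ b₄`, `p⁵ ∣ b₆`)
# (cell `b2b-bsdres`, team n1011, seat p04 gen 3, OWNERS row T-b9-K 'Kodaira bridge' for T-b9)

HONEST FRAMING (cell `b2b-bsdres`, run/shared/lean/b2b/bsd-rank1-residual/, verbatim in every
file): the goal of the cell is to DELETE the COMBINATION-SHAPED residual classes of the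
Birch–Swinnerton-Dyer formula for ALL analytic-rank `≤ 1` elliptic curves over `ℚ` — "full BSD
formula for every rank `≤ 1` curve in class `C`" assembled STRICTLY from published theorems — so
that the rank-`≤ 1` remainder becomes exactly the CONSTRUCTION-SHAPED classes, which are TYPED
(missing-input `Prop`s), NOT attempted. This is not "finishing BSD". Team n1011 (N10 / N11, the
additive block X4 ∧ `p = 3`): research route on the CONSTRUCTION-SHAPED class X4; no claim beyond the
stated classes; nothing is booked. Theorems only (no definition, no named fact).

## What this file proves (stub K = "Kodaira bridge" of `cells/n1011/skel/T-b9-tame-tower.md`)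

The valuation lemmas of steps S1/S2 of T-b9 (`TameThreeTorsionValuation*`, `TameNineTorsionValuation`)
are stated for an INTEGRAL Weierstrass equation `V : WeierstrassCurve ℤ` in `III`-shape
`3 ∣ b₂, 3 ∣ b₄, ¬ 9 ∣ b₄, 9 ∣ b₆`.  This file supplies such a `V` from the Kodaira symbol of a
globally minimal `W / ℚ` at a place `v` of `𝓞 ℚ` with rational prime `p = natGenerator v` below it:

* (K1) `exists_int_translate_IIIShape_of_kodairaSymbolAt_eq_III` — `v ∤ 2`, `W.kodairaSymbolAt v = III`
  ⟹ some integer `r` makes `V = (1; r, 0, 0) • integralModelInt W` (`x ↦ x + r`) satisfy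
  `p ∣ b₂(V)`, `p ∣ b₄(V)`, `p² ∤ b₄(V)`, `p² ∣ b₆(V)`; at `p = 3`: `exists_int_translate_IIIShape_three`
  (`3 ∣ b₂, 3 ∣ b₄, ¬ 9 ∣ b₄, 9 ∣ b₆`).
* (K2) `exists_int_translate_IIIstarShape_of_kodairaSymbolAt_eq_IIIstar` — type `III*`:
  `p² ∣ b₂`, `p³ ∣ b₄`, `p⁴ ∤ b₄`, `p⁵ ∣ b₆`; at `p = 3`: `exists_int_translate_IIIstarShape_three`
  (`9 ∣ b₂, 27 ∣ b₄, ¬ 81 ∣ b₄, 243 ∣ b₆`).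
* (K3) `map_translate_integralModelInt` — the `ℚ`-model of the translate is `(1; r, 0, 0) • W`, hence
  elliptic (`isElliptic_map_translate_integralModelInt`) with the same mod-`n` Galois images:
  `hasSurjectiveModNGaloisRep_map_translate_iff`, `forall_hasSurjectiveModNGaloisRep_pow_map_translate_iff`
  (model independence, tree `hasSurjectiveModNGaloisRep_smul_iff`); packaged at `3`:
  `exists_IIIShape_intModel_three`, `exists_IIIstarShape_intModel_three`.

Proof of K1/K2.  Global minimality makes `W ⊗ ℚ_v` a minimal equation over `𝓞_v`, so
`W.kodairaSymbolAt v` is Tate's algorithm run on `integralModelInt W ⊗ 𝓞_v`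
(`kodairaSymbolAt_eq_kodairaSymbolOfMinimal_of_isMinimal`; here
`kodairaSymbolAt_eq_kodairaSymbolOfMinimal_integralModelInt`); the local half
(`TameThreeKodairaShapeLocal`: Silverman *ATAEC* IV.9.4 Steps 2–4 / 6–9 via the tree's normal forms
`LocalIndex.exists_smul_of_kodairaSymbolOfMinimal_eq_III/_IIIstar`) gives `r_v ∈ 𝓞_v`; `ℤ` is dense
in `𝓞_v` (`Rat.exists_nat_valued_sub_le`), the shapes are stable under `r ↦ r + d`, `d ∈ 𝔪_v`
(resp. `𝔪_v²`), and for an integer `n`, `n ∈ 𝔪_vᵏ ⟺ pᵏ ∣ n`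
(`intCast_mem_maximalIdeal_adicCompletionIntegers_pow_iff`).  No torsion point, Galois group or named
fact is used; nothing is specific to `p = 3` except the numeral corollaries.

References: J. Tate, *Algorithm for determining the type of a singular fiber in an elliptic pencil*,
LNM 476 (1975) §§7–8; J. H. Silverman, *ATAEC* IV.9.4 Steps 2–4 and 6–9 (types `III`, `III*`);
J. H. Silverman, *AEC* III.1 Table 3.1, III.3.1(b), VII.1.3, VIII.8 (global minimal models).
-/

noncomputable section

open scoped Classical NumberField

open WeierstrassCurve IsLocalRing IsDedekindDomain NumberField

namespace Summit.BirchSwinnertonDyer.Rank1Residual.GaloisImage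

/-! ### §3. At a finite place `v` of `𝓞 ℚ`: `𝓞_v`, its uniformiser `p_v`, integers in `𝔪_vᵏ` -/

section Rat

open Rat.HeightOneSpectrum IsDedekindDomain.HeightOneSpectrum
  Literature.NumberTheory.GaloisRepresentations

variable (v : HeightOneSpectrum (𝓞 ℚ))

/-- In `ℚ_v`, the image of `p_v ∈ 𝓞_v` is the rational prime `p_v`. [folklore] -/
theorem coe_natGenerator_adicCompletionIntegers :
    (((natGenerator v : ℕ) : v.adicCompletionIntegers ℚ) : v.adicCompletion ℚ) =
      ((natGenerator v : ℕ) : v.adicCompletion ℚ) := by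
  norm_cast

/-- `v(p_vᵏ) = exp (-k)` in `ℚ_v`. [folklore] -/
theorem valued_natGenerator_pow (k : ℕ) :
    Valued.v ((((natGenerator v : ℕ) : v.adicCompletionIntegers ℚ) : v.adicCompletion ℚ) ^ k) =
      WithZero.exp (-(k : ℤ)) := by
  rw [map_pow, coe_natGenerator_adicCompletionIntegers, Rat.valued_natGenerator,
    ← WithZero.exp_nsmul]
  simp

/-- **`p_v` is a uniformiser of `𝓞_v`** (irreducible; `v(p_v) = exp (-1)`). [folklore] -/
theorem irreducible_natGenerator_adicCompletionIntegers :
    Irreducible ((natGenerator v : ℕ) : v.adicCompletionIntegers ℚ) :=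
  irreducible_adicCompletionIntegers_of_valued_eq v _ (by
    rw [coe_natGenerator_adicCompletionIntegers]; exact Rat.valued_natGenerator v)

/-- For an integer `n`: `v(n) ≤ exp (-k) ⟺ p_vᵏ ∣ n`. [folklore] -/
theorem valuation_intCast_le_iff (n : ℤ) (k : ℕ) :
    v.valuation ℚ (n : ℚ) ≤ WithZero.exp (-(k : ℤ)) ↔ ((natGenerator v : ℕ) : ℤ) ^ k ∣ n := by
  refine ⟨fun h ↦ ?_, Rat.valuation_intCast_le v⟩
  rw [Rat.valuation_intCast, intValuation_le_pow_iff_mem, Rat.asIdeal_eq_span_natGenerator,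
    Ideal.span_singleton_pow, Ideal.mem_span_singleton] at h
  have h' := map_dvd (Rat.ringOfIntegersEquiv : 𝓞 ℚ ≃+* ℤ) h
  simpa using h'

/-- **For an integer `n`: `n ∈ 𝔪_vᵏ ⟺ p_vᵏ ∣ n`** (`𝔪_vᵏ = p_vᵏ 𝓞_v`, and `v(n) ≤ exp(-k) ⟺ p_vᵏ ∣ n`).
[folklore] -/
theorem intCast_mem_maximalIdeal_adicCompletionIntegers_pow_iff (n : ℤ) (k : ℕ) :
    ((n : ℤ) : v.adicCompletionIntegers ℚ) ∈ maximalIdeal (v.adicCompletionIntegers ℚ) ^ k ↔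
      ((natGenerator v : ℕ) : ℤ) ^ k ∣ n := by
  rw [adicCompletionIntegers.mem_maximalIdeal_pow_iff ℚ v
    (irreducible_natGenerator_adicCompletionIntegers v) k, valued_natGenerator_pow,
    ← valuation_intCast_le_iff]
  have : (((n : ℤ) : v.adicCompletionIntegers ℚ) : v.adicCompletion ℚ) =
      algebraMap ℚ (v.adicCompletion ℚ) (n : ℚ) := by
    push_cast; exact (map_intCast _ n).symm
  rw [this, WeierstrassCurve.valued_algebraMap_adicCompletion]

/-- `n ∈ 𝔪_v ⟺ p_v ∣ n` for an integer `n`. [folklore] -/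
theorem intCast_mem_maximalIdeal_adicCompletionIntegers_iff (n : ℤ) :
    ((n : ℤ) : v.adicCompletionIntegers ℚ) ∈ maximalIdeal (v.adicCompletionIntegers ℚ) ↔
      ((natGenerator v : ℕ) : ℤ) ∣ n := by
  simpa using intCast_mem_maximalIdeal_adicCompletionIntegers_pow_iff v n 1

/-- **`ℤ` is dense in `𝓞_v`**: every `x ∈ 𝓞_v` is congruent to a natural number modulo `𝔪_vᵏ`
(`Rat.exists_nat_valued_sub_le`, read in `𝔪_vᵏ`). [folklore] -/
theorem exists_nat_sub_mem_maximalIdeal_pow (x : v.adicCompletionIntegers ℚ) (k : ℕ) :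
    ∃ d : ℕ, ((d : ℤ) : v.adicCompletionIntegers ℚ) - x ∈
      maximalIdeal (v.adicCompletionIntegers ℚ) ^ k := by
  obtain ⟨d, hd⟩ := Rat.exists_nat_valued_sub_le v (x : v.adicCompletion ℚ)
    ((mem_adicCompletionIntegers (𝓞 ℚ) ℚ v).mp x.2) k
  refine ⟨d, ?_⟩
  have hmem : x - ((d : ℤ) : v.adicCompletionIntegers ℚ) ∈
      maximalIdeal (v.adicCompletionIntegers ℚ) ^ k := by
    rw [adicCompletionIntegers.mem_maximalIdeal_pow_iff ℚ v
      (irreducible_natGenerator_adicCompletionIntegers v) k, valued_natGenerator_pow]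
    push_cast
    simpa using hd
  rw [← Ideal.neg_mem_iff, neg_sub]
  exact hmem

/-- `2 ∈ 𝓞_vˣ` at a place `v ∤ 2`. [folklore] -/
theorem isUnit_two_adicCompletionIntegers_of_ne (hv2 : natGenerator v ≠ 2) :
    IsUnit (2 : v.adicCompletionIntegers ℚ) := by
  have h : ((2 : ℕ) : 𝓞 ℚ) ∉ v.asIdeal := by
    intro hmem
    have hdvd := (Rat.natCast_mem_asIdeal_iff v).mp hmem
    exact hv2 ((Nat.prime_dvd_prime_iff_eq (prime_natGenerator v) Nat.prime_two).mp hdvd)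
  have h2 := isUnit_algebraMap_adicCompletionIntegers ℚ v h
  have e : algebraMap (𝓞 ℚ) (v.adicCompletionIntegers ℚ) ((2 : ℕ) : 𝓞 ℚ) = 2 := by
    rw [map_natCast]; norm_num
  rwa [e] at h2

/-! ### §4. The Kodaira symbol of a global minimal model is Tate's algorithm on `integralModelInt W` -/

variable (W : WeierstrassCurve ℚ)

/-- The base change to `ℚ_v` of `W` is that of its integer model `integralModelInt W ⊗ 𝓞_v`
(`ℤ → ℚ_v` is unique). [folklore] -/
theorem baseChange_eq_map_integralModelInt [W.IsGloballyMinimal] :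
    W.baseChange (v.adicCompletion ℚ) =
      ((integralModelInt W).map (Int.castRingHom (v.adicCompletionIntegers ℚ))).map
        (algebraMap (v.adicCompletionIntegers ℚ) (v.adicCompletion ℚ)) := by
  conv_lhs => rw [← map_integralModelInt W]
  rw [baseChange, map_map, map_map]
  congr 1
  exact RingHom.ext_int _ _

/-- **`W.kodairaSymbolAt v` is Tate's algorithm run on `integralModelInt W` over `𝓞_v`** for a
globally minimal `W` (`W ⊗ ℚ_v` is `𝓞_v`-minimal, `IsGloballyMinimal.isMinimal`;
`kodairaSymbolAt_eq_kodairaSymbolOfMinimal_of_isMinimal`; Mathlib's integral model of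
`integralModelInt W ⊗ ℚ_v` is `integralModelInt W ⊗ 𝓞_v`). Silverman *AEC* VIII.8, *ATAEC* IV.9.4.
[cite: SilvermanAEC2009, VII.1 Prop. 1.3(b) and VIII.8] -/
theorem kodairaSymbolAt_eq_kodairaSymbolOfMinimal_integralModelInt [W.IsElliptic]
    [W.IsGloballyMinimal] :
    W.kodairaSymbolAt v =
      ((integralModelInt W).map
        (Int.castRingHom (v.adicCompletionIntegers ℚ))).kodairaSymbolOfMinimal := by
  haveI := WeierstrassCurve.perfectField_residueField_adicCompletionIntegers (K := ℚ) v
  haveI hmin : (W.baseChange (v.adicCompletion ℚ)).IsMinimal (v.adicCompletionIntegers ℚ) :=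
    IsGloballyMinimal.isMinimal (W := W) v
  have hΔ : (W.baseChange (v.adicCompletion ℚ)).Δ ≠ 0 := by
    rw [baseChange, map_Δ]
    exact (map_ne_zero_iff _ (algebraMap ℚ (v.adicCompletion ℚ)).injective).mpr
      W.isUnit_Δ.ne_zero
  rw [kodairaSymbolAt_eq_kodairaSymbolOfMinimal_of_isMinimal v W
    (W.baseChange (v.adicCompletion ℚ)) 1 (one_smul _ _).symm hΔ]
  congr 1
  apply map_injective
    (IsFractionRing.injective (v.adicCompletionIntegers ℚ) (v.adicCompletion ℚ))
  change ((W.baseChange (v.adicCompletion ℚ)).integralModel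
      (v.adicCompletionIntegers ℚ)).baseChange (v.adicCompletion ℚ) = _
  rw [baseChange_integralModel_eq]
  exact baseChange_eq_map_integralModelInt v W

/-- The change of variables `(1; r, 0, 0)` over `ℤ` maps to `(1; r, 0, 0)` over any ring. [folklore] -/
theorem map_translate_variableChange {S : Type*} [CommRing S] (φ : ℤ →+* S) (r : ℤ) :
    (⟨1, r, 0, 0⟩ : VariableChange ℤ).map φ = (⟨1, φ r, 0, 0⟩ : VariableChange S) := by
  simp [VariableChange.map]

/-- The integer translate, mapped to `𝓞_v`, is the translate of `integralModelInt W ⊗ 𝓞_v`.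
[folklore] -/
theorem map_translate_integralModelInt_adicCompletionIntegers [W.IsGloballyMinimal] (r : ℤ) :
    (((⟨1, r, 0, 0⟩ : VariableChange ℤ) • integralModelInt W).map
        (Int.castRingHom (v.adicCompletionIntegers ℚ))) =
      (⟨1, ((r : ℤ) : v.adicCompletionIntegers ℚ), 0, 0⟩ :
          VariableChange (v.adicCompletionIntegers ℚ)) •
        (integralModelInt W).map (Int.castRingHom (v.adicCompletionIntegers ℚ)) := by
  rw [← map_variableChange, map_translate_variableChange]
  rfl

/-! ### §5. K1 / K2: the integer translates in `III`- and `III*`-shape -/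

/-- **K1 (type `III`, any place `v ∤ 2` of `ℚ`).** For `W / ℚ` elliptic and globally minimal with
`W.kodairaSymbolAt v = III`, some INTEGER translate `V = (1; r, 0, 0) • integralModelInt W`
(`x ↦ x + r`) is in `III`-shape at `p = p_v`: `p ∣ b₂(V)`, `p ∣ b₄(V)`, `p² ∤ b₄(V)`, `p² ∣ b₆(V)`
(Tate's algorithm Steps 2–4 on the minimal model, the singular point moved to an INTEGER abscissa
`r ≡ r_v (mod p)`; Silverman *ATAEC* IV.9.4 Step 4: "`π ∣ a₃, a₄, a₆`", "`π² ∣ a₆`", "`π³ ∤ b₈`").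
[cite: SilvermanATAEC1994, IV.9.4 Steps 2–4] -/
theorem exists_int_translate_IIIShape_of_kodairaSymbolAt_eq_III [W.IsElliptic]
    [W.IsGloballyMinimal] (hv2 : natGenerator v ≠ 2) (hW : W.kodairaSymbolAt v = .III) :
    ∃ r : ℤ,
      ((natGenerator v : ℕ) : ℤ) ∣ ((⟨1, r, 0, 0⟩ : VariableChange ℤ) • integralModelInt W).b₂ ∧
      ((natGenerator v : ℕ) : ℤ) ∣ ((⟨1, r, 0, 0⟩ : VariableChange ℤ) • integralModelInt W).b₄ ∧
      ¬ ((natGenerator v : ℕ) : ℤ) ^ 2 ∣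
          ((⟨1, r, 0, 0⟩ : VariableChange ℤ) • integralModelInt W).b₄ ∧
      ((natGenerator v : ℕ) : ℤ) ^ 2 ∣
          ((⟨1, r, 0, 0⟩ : VariableChange ℤ) • integralModelInt W).b₆ := by
  haveI := WeierstrassCurve.perfectField_residueField_adicCompletionIntegers (K := ℚ) v
  set I := (integralModelInt W).map (Int.castRingHom (v.adicCompletionIntegers ℚ)) with hI
  have hT : I.kodairaSymbolOfMinimal = .III := by
    rw [hI, ← kodairaSymbolAt_eq_kodairaSymbolOfMinimal_integralModelInt v W, hW]
  obtain ⟨r₀, h₂, h₄, h₄', h₆⟩ := exists_translate_IIIShape_of_kodairaSymbolOfMinimal_eq_III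
    (isUnit_two_adicCompletionIntegers_of_ne v hv2) I hT
  obtain ⟨d, hd⟩ := exists_nat_sub_mem_maximalIdeal_pow v r₀ 1
  rw [pow_one] at hd
  obtain ⟨k₂, k₄, k₄', k₆⟩ :=
    IIIShape_translate_of_sub_mem I (maximalIdeal (v.adicCompletionIntegers ℚ)) hd h₂ h₄ h₄' h₆
  rw [← map_translate_integralModelInt_adicCompletionIntegers v W] at k₂ k₄ k₄' k₆
  rw [map_b₂, eq_intCast, intCast_mem_maximalIdeal_adicCompletionIntegers_iff] at k₂
  rw [map_b₄, eq_intCast, intCast_mem_maximalIdeal_adicCompletionIntegers_iff] at k₄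
  rw [map_b₄, eq_intCast, intCast_mem_maximalIdeal_adicCompletionIntegers_pow_iff] at k₄'
  rw [map_b₆, eq_intCast, intCast_mem_maximalIdeal_adicCompletionIntegers_pow_iff] at k₆
  exact ⟨d, k₂, k₄, k₄', k₆⟩

/-- **K2 (type `III*`, any place `v ∤ 2` of `ℚ`).** For `W / ℚ` elliptic and globally minimal with
`W.kodairaSymbolAt v = III*`, some INTEGER translate `V = (1; r, 0, 0) • integralModelInt W` is in
`III*`-shape at `p = p_v`: `p² ∣ b₂(V)`, `p³ ∣ b₄(V)`, `p⁴ ∤ b₄(V)`, `p⁵ ∣ b₆(V)` (Tate's algorithm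
Steps 2, 6, 8, 9; `r ≡ r_v (mod p²)`; Silverman *ATAEC* IV.9.4 Step 9: "`π³ ∣ a₃`, `π⁵ ∣ a₆`",
"`π⁴ ∤ a₄`"). [cite: SilvermanATAEC1994, IV.9.4 Steps 6–9] -/
theorem exists_int_translate_IIIstarShape_of_kodairaSymbolAt_eq_IIIstar [W.IsElliptic]
    [W.IsGloballyMinimal] (hv2 : natGenerator v ≠ 2) (hW : W.kodairaSymbolAt v = .IIIstar) :
    ∃ r : ℤ,
      ((natGenerator v : ℕ) : ℤ) ^ 2 ∣
          ((⟨1, r, 0, 0⟩ : VariableChange ℤ) • integralModelInt W).b₂ ∧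
      ((natGenerator v : ℕ) : ℤ) ^ 3 ∣
          ((⟨1, r, 0, 0⟩ : VariableChange ℤ) • integralModelInt W).b₄ ∧
      ¬ ((natGenerator v : ℕ) : ℤ) ^ 4 ∣
          ((⟨1, r, 0, 0⟩ : VariableChange ℤ) • integralModelInt W).b₄ ∧
      ((natGenerator v : ℕ) : ℤ) ^ 5 ∣
          ((⟨1, r, 0, 0⟩ : VariableChange ℤ) • integralModelInt W).b₆ := by
  haveI := WeierstrassCurve.perfectField_residueField_adicCompletionIntegers (K := ℚ) v
  set I := (integralModelInt W).map (Int.castRingHom (v.adicCompletionIntegers ℚ)) with hI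
  have hT : I.kodairaSymbolOfMinimal = .IIIstar := by
    rw [hI, ← kodairaSymbolAt_eq_kodairaSymbolOfMinimal_integralModelInt v W, hW]
  obtain ⟨r₀, h₂, h₄, h₄', h₆⟩ :=
    exists_translate_IIIstarShape_of_kodairaSymbolOfMinimal_eq_IIIstar
      (isUnit_two_adicCompletionIntegers_of_ne v hv2) I hT
  obtain ⟨d, hd⟩ := exists_nat_sub_mem_maximalIdeal_pow v r₀ 2
  obtain ⟨k₂, k₄, k₄', k₆⟩ :=
    IIIstarShape_translate_of_sub_mem I (maximalIdeal (v.adicCompletionIntegers ℚ)) hd h₂ h₄ h₄' h₆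
  rw [← map_translate_integralModelInt_adicCompletionIntegers v W] at k₂ k₄ k₄' k₆
  rw [map_b₂, eq_intCast, intCast_mem_maximalIdeal_adicCompletionIntegers_pow_iff] at k₂
  rw [map_b₄, eq_intCast, intCast_mem_maximalIdeal_adicCompletionIntegers_pow_iff] at k₄
  rw [map_b₄, eq_intCast, intCast_mem_maximalIdeal_adicCompletionIntegers_pow_iff] at k₄'
  rw [map_b₆, eq_intCast, intCast_mem_maximalIdeal_adicCompletionIntegers_pow_iff] at k₆
  exact ⟨d, k₂, k₄, k₄', k₆⟩

/-- **K1 at `p = 3`** (the hypothesis shape of `TameThreeTorsionValuation`): Kodaira type `III` at the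
place over `3` ⟹ an integer translate `V = (1; r, 0, 0) • integralModelInt W` with
`3 ∣ b₂(V)`, `3 ∣ b₄(V)`, `¬ 9 ∣ b₄(V)`, `9 ∣ b₆(V)`. [cite: SilvermanATAEC1994, IV.9.4 Steps 2–4] -/
theorem exists_int_translate_IIIShape_three [W.IsElliptic] [W.IsGloballyMinimal]
    (hv : natGenerator v = 3) (hW : W.kodairaSymbolAt v = .III) :
    ∃ r : ℤ,
      (3 : ℤ) ∣ ((⟨1, r, 0, 0⟩ : VariableChange ℤ) • integralModelInt W).b₂ ∧
      (3 : ℤ) ∣ ((⟨1, r, 0, 0⟩ : VariableChange ℤ) • integralModelInt W).b₄ ∧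
      ¬ (9 : ℤ) ∣ ((⟨1, r, 0, 0⟩ : VariableChange ℤ) • integralModelInt W).b₄ ∧
      (9 : ℤ) ∣ ((⟨1, r, 0, 0⟩ : VariableChange ℤ) • integralModelInt W).b₆ := by
  obtain ⟨r, h⟩ := exists_int_translate_IIIShape_of_kodairaSymbolAt_eq_III v W
    (by rw [hv]; decide) hW
  rw [hv] at h
  norm_num at h
  exact ⟨r, h⟩

/-- **K2 at `p = 3`**: Kodaira type `III*` at the place over `3` ⟹ an integer translate
`V = (1; r, 0, 0) • integralModelInt W` with `9 ∣ b₂(V)`, `27 ∣ b₄(V)`, `¬ 81 ∣ b₄(V)`,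
`243 ∣ b₆(V)`. [cite: SilvermanATAEC1994, IV.9.4 Steps 6–9] -/
theorem exists_int_translate_IIIstarShape_three [W.IsElliptic] [W.IsGloballyMinimal]
    (hv : natGenerator v = 3) (hW : W.kodairaSymbolAt v = .IIIstar) :
    ∃ r : ℤ,
      (9 : ℤ) ∣ ((⟨1, r, 0, 0⟩ : VariableChange ℤ) • integralModelInt W).b₂ ∧
      (27 : ℤ) ∣ ((⟨1, r, 0, 0⟩ : VariableChange ℤ) • integralModelInt W).b₄ ∧
      ¬ (81 : ℤ) ∣ ((⟨1, r, 0, 0⟩ : VariableChange ℤ) • integralModelInt W).b₄ ∧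
      (243 : ℤ) ∣ ((⟨1, r, 0, 0⟩ : VariableChange ℤ) • integralModelInt W).b₆ := by
  obtain ⟨r, h⟩ := exists_int_translate_IIIstarShape_of_kodairaSymbolAt_eq_IIIstar v W
    (by rw [hv]; decide) hW
  rw [hv] at h
  norm_num at h
  exact ⟨r, h⟩

end Rat

/-! ### §6. K3: the `ℚ`-model of the integer translate and the transport of `ρ̄_{E,n}` -/

section Transport

open Literature.NumberTheory.EllipticCurves

variable (W : WeierstrassCurve ℚ)

/-- **The `ℚ`-model of the integer translate is `(1; r, 0, 0) • W`.** [folklore] -/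
theorem map_translate_integralModelInt [W.IsGloballyMinimal] (r : ℤ) :
    (((⟨1, r, 0, 0⟩ : VariableChange ℤ) • integralModelInt W).map (Int.castRingHom ℚ)) =
      (⟨1, (r : ℚ), 0, 0⟩ : VariableChange ℚ) • W := by
  rw [← map_variableChange, map_integralModelInt, map_translate_variableChange]
  rfl

/-- The `ℚ`-model of the integer translate is an elliptic curve. [folklore] -/
theorem isElliptic_map_translate_integralModelInt [W.IsElliptic] [W.IsGloballyMinimal] (r : ℤ) :
    (((⟨1, r, 0, 0⟩ : VariableChange ℤ) • integralModelInt W).map (Int.castRingHom ℚ)).IsElliptic := by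
  rw [map_translate_integralModelInt]
  infer_instance

/-- **K3.** `ρ̄_{V ⊗ ℚ, n}` is surjective iff `ρ̄_{W, n}` is, for the integer translate `V`
(model independence of the mod-`n` image, tree `hasSurjectiveModNGaloisRep_smul_iff`;
Silverman *AEC* III.3.1(b)). [folklore] -/
theorem hasSurjectiveModNGaloisRep_map_translate_iff [W.IsGloballyMinimal] (r : ℤ) (n : ℤ) :
    (((⟨1, r, 0, 0⟩ : VariableChange ℤ) • integralModelInt W).map
        (Int.castRingHom ℚ)).HasSurjectiveModNGaloisRep n ↔
      W.HasSurjectiveModNGaloisRep n := by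
  rw [map_translate_integralModelInt]
  exact hasSurjectiveModNGaloisRep_smul_iff W _ n

/-- **K3, tower form.** `∀ n, ρ̄_{V ⊗ ℚ, ℓⁿ}` onto ⟺ `∀ n, ρ̄_{W, ℓⁿ}` onto, for the integer translate
`V`. [folklore] -/
theorem forall_hasSurjectiveModNGaloisRep_pow_map_translate_iff [W.IsGloballyMinimal] (r : ℤ)
    (ℓ : ℤ) :
    (∀ n : ℕ, (((⟨1, r, 0, 0⟩ : VariableChange ℤ) • integralModelInt W).map
        (Int.castRingHom ℚ)).HasSurjectiveModNGaloisRep (ℓ ^ n)) ↔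
      ∀ n : ℕ, W.HasSurjectiveModNGaloisRep (ℓ ^ n) :=
  forall_congr' fun _ ↦ hasSurjectiveModNGaloisRep_map_translate_iff W r _

/-- **K1 + K3 packaged at `p = 3`.** Kodaira type `III` at the place over `3` ⟹ an integral
equation `V` (an integer translate of the global minimal model) in `III`-shape
`3 ∣ b₂, 3 ∣ b₄, ¬ 9 ∣ b₄, 9 ∣ b₆`, whose `ℚ`-model is an elliptic curve with the same mod-`n` Galois
images as `W` for every `n`. [cite: SilvermanATAEC1994, IV.9.4 Steps 2–4] -/
theorem exists_IIIShape_intModel_three [W.IsElliptic] [W.IsGloballyMinimal]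
    (v : HeightOneSpectrum (𝓞 ℚ)) (hv : Rat.HeightOneSpectrum.natGenerator v = 3)
    (hW : W.kodairaSymbolAt v = .III) :
    ∃ V : WeierstrassCurve ℤ, (∃ r : ℤ, V = (⟨1, r, 0, 0⟩ : VariableChange ℤ) • integralModelInt W ∧
        V.map (Int.castRingHom ℚ) = (⟨1, (r : ℚ), 0, 0⟩ : VariableChange ℚ) • W) ∧
      (3 : ℤ) ∣ V.b₂ ∧ (3 : ℤ) ∣ V.b₄ ∧ ¬ (9 : ℤ) ∣ V.b₄ ∧ (9 : ℤ) ∣ V.b₆ ∧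
      (V.map (Int.castRingHom ℚ)).IsElliptic ∧
      ∀ n : ℤ, (V.map (Int.castRingHom ℚ)).HasSurjectiveModNGaloisRep n ↔
        W.HasSurjectiveModNGaloisRep n := by
  obtain ⟨r, h₂, h₄, h₄', h₆⟩ := exists_int_translate_IIIShape_three v W hv hW
  exact ⟨_, ⟨r, rfl, map_translate_integralModelInt W r⟩, h₂, h₄, h₄', h₆,
    isElliptic_map_translate_integralModelInt W r,
    fun n ↦ hasSurjectiveModNGaloisRep_map_translate_iff W r n⟩

/-- **K2 + K3 packaged at `p = 3`.** Kodaira type `III*` at the place over `3` ⟹ an integral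
equation `V` (an integer translate of the global minimal model) in `III*`-shape
`9 ∣ b₂, 27 ∣ b₄, ¬ 81 ∣ b₄, 243 ∣ b₆`, with elliptic `ℚ`-model and the same mod-`n` images.
[cite: SilvermanATAEC1994, IV.9.4 Steps 6–9] -/
theorem exists_IIIstarShape_intModel_three [W.IsElliptic] [W.IsGloballyMinimal]
    (v : HeightOneSpectrum (𝓞 ℚ)) (hv : Rat.HeightOneSpectrum.natGenerator v = 3)
    (hW : W.kodairaSymbolAt v = .IIIstar) :
    ∃ V : WeierstrassCurve ℤ, (∃ r : ℤ, V = (⟨1, r, 0, 0⟩ : VariableChange ℤ) • integralModelInt W ∧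
        V.map (Int.castRingHom ℚ) = (⟨1, (r : ℚ), 0, 0⟩ : VariableChange ℚ) • W) ∧
      (9 : ℤ) ∣ V.b₂ ∧ (27 : ℤ) ∣ V.b₄ ∧ ¬ (81 : ℤ) ∣ V.b₄ ∧ (243 : ℤ) ∣ V.b₆ ∧
      (V.map (Int.castRingHom ℚ)).IsElliptic ∧
      ∀ n : ℤ, (V.map (Int.castRingHom ℚ)).HasSurjectiveModNGaloisRep n ↔
        W.HasSurjectiveModNGaloisRep n := by
  obtain ⟨r, h₂, h₄, h₄', h₆⟩ := exists_int_translate_IIIstarShape_three v W hv hW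
  exact ⟨_, ⟨r, rfl, map_translate_integralModelInt W r⟩, h₂, h₄, h₄', h₆,
    isElliptic_map_translate_integralModelInt W r,
    fun n ↦ hasSurjectiveModNGaloisRep_map_translate_iff W r n⟩

end Transport

end Summit.BirchSwinnertonDyer.Rank1Residual.GaloisImage

end
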